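import Summits.HodgeConjecture.CorCM.MumfordTateRankRibetTypeOneData
import Summits.HodgeConjecture.CorCM.MumfordTateRankUnitaryPairSplitting
import Summits.HodgeConjecture.CorCM.MumfordTateRankUnitaryPairCentre
import Summits.HodgeConjecture.CorCM.MumfordTateRankUnitaryPairCount
import Summits.HodgeConjecture.CorCM.MumfordTateRankSubadditive
import Summits.HodgeConjecture.CorCM.MumfordTateRankOfPowers
import Literature.AlgebraicGeometry.Motives.AbelianVarietySimpleOfEndAlgebraDomain
import Literature.AlgebraicGeometry.Motives.AbelianVarietyEndAlgebraIsogenyInvariance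
import HarnessLib

/-!
# Two Ribet-type abelian varieties `A`, `A′` of types `(g−1,1)`, `(g′−1,1)`: `t(A × A′) = g² + g′² + 1` for non-isomorphic fields,
# `t(A × A′) = 2g²` for `g = g′`, a common root and `A ≁ A′`, and `t(A × A′) ≥ g² + g′²` whenever `A ≁ A′`
# (the unitary Lemma (3.4) in every dimension: `Hg(A × A′) ⊇ SU(H¹A) × SU(H¹A′)`)

COR-CM (cell `pub-hodgecm2`, seat `b27` gen 53, count-neutral Mumford–Tate-rank ladder; theorems only, no definition, no named fact; UNCONDITIONAL —
nothing here uses or asserts HC_CM).  `t := dim MT(H¹·)`.  RIBET TYPE `(g − 1, 1)`: `dim A = g ≥ 3`, `φ ∘ φ = −d` (`d > 0`), `dim_ℚ End⁰A = 2`,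
multiplicity one at `± i√d`, `End⁰A` a field not totally real; then `t(A) = g² + 1` (`CorCM/MumfordTateRankRibetTypeOne`).  The tree knew, for
two such varieties OF THE SAME DIMENSION with a COMMON root `φ ∘ φ = −D = φ′ ∘ φ′`: `g² + 1 ≤ t(A × A′) ≤ 2g²` (the Weil classes of the diagonal
action, `CorCM/MumfordTateRankTypeIVThreefoldPairs`), and for threefolds the exact trichotomy `10 / 18 / 19` (gen 52,
`CorCM/MumfordTateRankTypeIVThreefoldPairsExact`).  HERE the matching lower bounds IN EVERY DIMENSION, by gen 52ʼs abstract chain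
`CorCM/MumfordTateRankUnitaryPair{Blocks,Intertwiner,Descent,Graph,Splitting,Centre,Count}` fed with `CorCM/MumfordTateRankRibetTypeOne{Derived,Data}`
(the derived algebras `𝔡_i = [Lie Hg(H¹A_i), Lie Hg(H¹A_i)]` are SIMPLE of dimensions `g_i² − 1` — `𝔡_i ⊗ ℂ ≅ 𝔰𝔩_{g_i}(ℂ)`; the factors are
`Θ`-rigid with skew centres `ℚφ_i^*`; a non-zero Hodge morphism `H¹A → H¹A′` would come from `Hom(A′, A) ≠ 0`, Riemann):
* §1 **`finrank_hodgeLie_hodge_one_prod_ribetTypeOne_ge`** — `dim Lie Hg(H¹(A × A′)) ≥ (g² − 1) + (g′² − 1) + 1` for `A ≁ A′`, and `+ 2` if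
  moreover there is no ring homomorphism `End⁰A′ → End⁰A` (trace test `tr(Θ_{A_i}φ_i^*) = ±2(g_i − 2)i√d_i ≠ 0`: the central plane).
* §2 **`mtRank_hodge_one_eq_of_isIsogenous_prod_ribetTypeOne_of_isEmpty_ringHom`** — NON-ISOMORPHIC FIELDS: `t(X) = g² + g′² + 1 =
  t(A) + t(A′) − 1` for `X ∼ A × A′` (`Hg(A × A′) = U(H¹A) × U(H¹A′)`; upper bound: subadditivity);
  **`mtRank_hodge_one_eq_of_isIsogenous_prod_ribetTypeOne_of_comp_self_eq_neg`** — same dimension, COMMON ROOT `D`, `A ≁ A′`: `t(X) = 2g²`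
  EXACTLY (upper bound: the Weil classes of the diagonal action, gen 48); **`mtRank_hodge_one_mem_Icc_of_isIsogenous_prod_ribetTypeOne`** —
  `A ≁ A′`: `g² + g′² ≤ t(X) ≤ g² + g′² + 1` in general; **`mtRank_hodge_one_dichotomy_of_isIsogenous_prod_ribetTypeOne_of_comp_self_eq_neg`** —
  same dimension and common root: `t(X) = g² + 1` (`A ∼ A′`) or `2g²` (`A ≁ A′`).

## References
* [MoonenZarhin1999LowDim] B. Moonen, Yu. G. Zarhin, *Hodge classes on abelian varieties of low dimension*, Math. Ann. 315 (1999), §3 (3.1),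
  Lemma (3.4), Prop. (3.8), Thm. 0.1 (4) [corpus: paper:arxiv-math_9901113 pp. 1–7]. [cite: MoonenZarhin1999LowDim, §3 (3.1), Lemma (3.4) and Prop. (3.8)]
* [Ribet1983] K. A. Ribet, *Hodge classes on certain types of abelian varieties*, Amer. J. Math. 105 (1983), Thm. 3. [cite: Ribet1983, Thm. 3]
* [Deligne1982HodgeCycles] P. Deligne, LNM 900 (1982), I §3 Prop. 3.4, Prop. 3.6, §4 Prop. 4.4. [cite: Deligne1982HodgeCycles, I §3 Prop. 3.6]
* [DeligneMilne1982Tannakian] P. Deligne, J. Milne, LNM 900 (1982), §6 Thm. 6.20 (Riemann). [cite: DeligneMilne1982Tannakian, §6 Thm. 6.20]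
* [MumfordAV1970] D. Mumford, *Abelian varieties*, §19 (isogenous varieties have isomorphic `End⁰`; `End⁰` a field ⟹ simple). [cite: MumfordAV1970, §19]
* [Humphreys1972] J. E. Humphreys, GTM 9 (1972), §19.2 (`A_l` simple). [cite: Humphreys1972, §19.2]
-/

noncomputable section

open scoped TensorProduct
open CategoryTheory CategoryTheory.Limits Module NumberField

namespace Summit.HodgeConjecture.CorCM

open Literature.AlgebraicGeometry.Motives
open Literature.AlgebraicGeometry.Motives.AbelianVariety
open Literature.AlgebraicGeometry.Motives.HodgeStructure
open Literature.AlgebraicGeometry.HodgeTheory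
open Literature.AlgebraicGeometry.ComplexMultiplication
open Literature.AlgebraicGeometry.Milne1999 (hom_eq_zero_of_isSimple_of_not_isIsogenous)

variable [HodgeTensorFacts.{0, 0}] {X : AbelianVariety ℂ} {n : ℕ}

/-! ## §1 The lower bounds `dim Lie Hg(H¹(A × A′)) ≥ g² + g′² − 1`, and `≥ g² + g′²` for non-isomorphic fields -/

set_option maxHeartbeats 800000 in
/-- **`dim Lie Hg(H¹(A × A′)) ≥ (g² − 1) + (g′² − 1) + 1` for two NON-ISOGENOUS abelian varieties of Ribet types `(g−1,1)`, `(g′−1,1)`, and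
`≥ (g² − 1) + (g′² − 1) + 2` when there is no ring homomorphism `End⁰A′ → End⁰A`**: `UnitaryPair.corners_le_and_finrank_le` (both derived corners
`𝔰𝔲(H¹A) ⊕ 𝔰𝔲(H¹A′)` and a central line), and for different fields `UnitaryPair.incl_phi_proj_mem_hodgeLie_of_nonresonant` +
`UnitaryPair.finrank_add_finrank_add_two_le_of_corners` (the central plane), fed with `ribetTypeOne_factor_data`, `derived_facts_of_ribetTypeOne`
(`𝔡_i` simple of dimension `g_i² − 1`) and Riemann's theorem (`Hom(A′, A) = 0` as `End⁰` is a field: `A`, `A′` simple).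
[cite: MoonenZarhin1999LowDim, §3 (3.1), Lemma (3.4) and Prop. (3.8)] [cite: DeligneMilne1982Tannakian, §6 Thm. 6.20] [cite: Ribet1983, Thm. 3] -/
theorem finrank_hodgeLie_hodge_one_prod_ribetTypeOne_ge {A A' : AbelianVariety ℂ} {m : ℕ} (hP : IsSmoothProjective m (A.prod A').X)
    (hF : IsField A.endAlgebra) (hnR : ¬ IsTotallyReal (EndField A hF)) (φ : A ⟶ A) {d : ℕ} (hd : 0 < d) (hφ : φ ≫ φ = -(d • 𝟙 A))
    (hAE : Module.finrank ℚ A.endAlgebra = 2)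
    (h1 : eigenMultiplicity A φ (Complex.I * (Real.sqrt d : ℂ)) = 1 ∨ eigenMultiplicity A φ (-(Complex.I * (Real.sqrt d : ℂ))) = 1) (hdim : 3 ≤ A.dim)
    (hF' : IsField A'.endAlgebra) (hnR' : ¬ IsTotallyReal (EndField A' hF')) (φ' : A' ⟶ A') {d' : ℕ} (hd' : 0 < d') (hφ' : φ' ≫ φ' = -(d' • 𝟙 A'))
    (hA'E : Module.finrank ℚ A'.endAlgebra = 2)
    (h1' : eigenMultiplicity A' φ' (Complex.I * (Real.sqrt d' : ℂ)) = 1 ∨ eigenMultiplicity A' φ' (-(Complex.I * (Real.sqrt d' : ℂ))) = 1)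
    (hdim' : 3 ≤ A'.dim) (hni : ¬ IsIsogenous A A') :
    haveI := BettiUniverse.finite hP 1
    (A.dim * A.dim - 1) + (A'.dim * A'.dim - 1) + 1 ≤ Module.finrank ℚ (BettiUniverse.hodge exists_isReal_hodgeModel_holds hP 1).hodgeLie ∧
      (IsEmpty (A'.endAlgebra →+* A.endAlgebra) →
        (A.dim * A.dim - 1) + (A'.dim * A'.dim - 1) + 2 ≤ Module.finrank ℚ (BettiUniverse.hodge exists_isReal_hodgeModel_holds hP 1).hodgeLie) := by
  classical
  have hnP : (A.prod A').dim = m := schemeDim_eq_holds hP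
  subst hnP
  have hT : IsSmoothProjective A.dim A.X := AbelianVariety.isSmoothProjective_holds
  have hT' : IsSmoothProjective A'.dim A'.X := AbelianVariety.isSmoothProjective_holds
  haveI := BettiUniverse.finite hP 1
  haveI := BettiUniverse.finite hT 1
  haveI := BettiUniverse.finite hT' 1
  haveI : Nontrivial (bettiCohomology A.X 1) := Module.nontrivial_of_finrank_pos (R := ℚ) (by rw [finrank_bettiCohomology_one A]; omega)
  haveI : Nontrivial (bettiCohomology A'.X 1) := Module.nontrivial_of_finrank_pos (R := ℚ) (by rw [finrank_bettiCohomology_one A']; omega)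
  have hAs : A.IsSimple := isSimple_of_isField_endAlgebra hF
  have hA's : A'.IsSimple := isSimple_of_isField_endAlgebra hF'
  -- per-factor data
  obtain ⟨μ₁, k₁, hφ₁E, hφ₁2, hE₁, hμ₁, h1₁, h2₁, hφ₁𝔥, hZ₁, hσ₁, hk₁, hτ₁⟩ := ribetTypeOne_factor_data hT φ hd hφ hAE h1 hdim
  obtain ⟨μ₂, k₂, hφ₂E, hφ₂2, hE₂, hμ₂, h1₂, h2₂, -, hZ₂, hσ₂, hk₂, hτ₂⟩ := ribetTypeOne_factor_data hT' φ' hd' hφ' hA'E h1' hdim'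
  obtain ⟨hsimple₁, hcent₁, h8₁⟩ := derived_facts_of_ribetTypeOne hT hF hnR φ hd hφ hAE h1 hdim
  obtain ⟨hsimple₂, hcent₂, h8₂⟩ := derived_facts_of_ribetTypeOne hT' hF' hnR' φ' hd' hφ' hA'E h1' hdim'
  set φ₁ : Module.End ℚ (bettiCohomology A.X 1) := (bettiCohomology.map φ.hom.hom.hom 1).hom with hφ₁
  set φ₂ : Module.End ℚ (bettiCohomology A'.X 1) := (bettiCohomology.map φ'.hom.hom.hom 1).hom with hφ₂
  obtain ⟨ψ₁⟩ := BettiUniverse.hodge_isPolarizable exists_isReal_hodgeModel_holds hT 1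
  obtain ⟨ψ₂⟩ := BettiUniverse.hodge_isPolarizable exists_isReal_hodgeModel_holds hT' 1
  obtain ⟨ψ⟩ := BettiUniverse.hodge_isPolarizable exists_isReal_hodgeModel_holds hP 1
  have heff₁ := BettiUniverse.hodge_isEffective exists_isReal_hodgeModel_holds hT 1
  have heff₂ := BettiUniverse.hodge_isEffective exists_isReal_hodgeModel_holds hT' 1
  have hd₁Q : (0 : ℚ) < d := Nat.cast_pos.2 hd
  have hd₂Q : (0 : ℚ) < d' := Nat.cast_pos.2 hd'
  -- the bicone of `H¹(A × A')`
  let ι₁ := BettiUniverse.pullHodgeHom exists_isReal_hodgeModel_holds hodgePQ_independent_of_hodgeModel_holds hP hT (fst A A').hom.hom.hom 1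
  let π₁ := BettiUniverse.pullHodgeHom exists_isReal_hodgeModel_holds hodgePQ_independent_of_hodgeModel_holds hT hP
    (prodLift (𝟙 A) (0 : A ⟶ A')).hom.hom.hom 1
  let ι₂ := BettiUniverse.pullHodgeHom exists_isReal_hodgeModel_holds hodgePQ_independent_of_hodgeModel_holds hP hT' (snd A A').hom.hom.hom 1
  let π₂ := BettiUniverse.pullHodgeHom exists_isReal_hodgeModel_holds hodgePQ_independent_of_hodgeModel_holds hT' hP
    (prodLift (0 : A' ⟶ A) (𝟙 A')).hom.hom.hom 1
  have hsumP : fst A A' ≫ prodLift (𝟙 A) (0 : A ⟶ A') + snd A A' ≫ prodLift (0 : A' ⟶ A) (𝟙 A') = 𝟙 _ := by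
    refine prod_hom_ext ?_ ?_
    · rw [Preadditive.add_comp, Category.assoc, Category.assoc, prodLift_fst, prodLift_fst, Category.comp_id, comp_zero, add_zero, Category.id_comp]
    · rw [Preadditive.add_comp, Category.assoc, Category.assoc, prodLift_snd, prodLift_snd, Category.comp_id, comp_zero, zero_add, Category.id_comp]
  have hπι₁ : ∀ v, π₁.toLinearMap (ι₁.toLinearMap v) = v := fun v => pull_pull_eq_self_of_comp_eq_id (prodLift_fst _ _) v
  have hπι₂ : ∀ v, π₂.toLinearMap (ι₂.toLinearMap v) = v := fun v => pull_pull_eq_self_of_comp_eq_id (prodLift_snd _ _) v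
  have hsum : ∀ v, ι₁.toLinearMap (π₁.toLinearMap v) + ι₂.toLinearMap (π₂.toLinearMap v) = v := fun v =>
    pull_pull_add_pull_pull_eq_self _ _ _ _ hsumP v
  -- the skew centre of `Lie Hg(H¹(A × A'))` is on `ℚ ι₁φ₁π₁ + ℚ ι₂φ₂π₂`
  have hZ : ∀ z ∈ (BettiUniverse.hodge exists_isReal_hodgeModel_holds hP 1).hodgeLie ⊓
      Subalgebra.toSubmodule (BettiUniverse.hodge exists_isReal_hodgeModel_holds hP 1).endAlg, ∃ x₁ x₂ : ℚ,
      z = x₁ • (ι₁.toLinearMap ∘ₗ φ₁ ∘ₗ π₁.toLinearMap) + x₂ • (ι₂.toLinearMap ∘ₗ φ₂ ∘ₗ π₂.toLinearMap) := by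
    intro z hz
    obtain ⟨hz𝔥, hzE⟩ := Submodule.mem_inf.1 hz
    rw [Subalgebra.mem_toSubmodule] at hzE
    have hb := eq_sum_blocks_of_mem_hodgeLie ι₁ π₁ ι₂ π₂ hπι₁ hπι₂ hsum hz𝔥
    obtain ⟨x₁, hx₁⟩ := hZ₁ ψ₁ _ (Submodule.mem_inf.2 ⟨comp_mem_hodgeLie_of_retract ι₁ π₁ hπι₁ hz𝔥,
      ((π₁.comp (endAlg.toHom ⟨z, hzE⟩)).comp ι₁).toLinearMap_mem_endAlg⟩)
    obtain ⟨x₂, hx₂⟩ := hZ₂ ψ₂ _ (Submodule.mem_inf.2 ⟨comp_mem_hodgeLie_of_retract ι₂ π₂ hπι₂ hz𝔥,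
      ((π₂.comp (endAlg.toHom ⟨z, hzE⟩)).comp ι₂).toLinearMap_mem_endAlg⟩)
    refine ⟨x₁, x₂, ?_⟩
    rw [hb, hx₁, hx₂]
    simp only [LinearMap.smul_comp, LinearMap.comp_smul]
  -- no non-zero Hodge morphism `H¹A → H¹A'` (Riemann: it would be `u^*`, `u : A' → A`, and `Hom(A', A) = 0`)
  have hAA : ∀ u : A' ⟶ A, u = 0 := hom_eq_zero_of_isSimple_of_not_isIsogenous hA's hAs (fun h => hni h.symm')
  have hnohom : ∀ f : bettiCohomology A.X 1 →ₗ[ℚ] bettiCohomology A'.X 1,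
      (∀ r : ℤ, ∀ x ∈ (BettiUniverse.hodge exists_isReal_hodgeModel_holds hT 1).piece r (((1 : ℕ) : ℤ) - r),
        f.baseChange ℂ x ∈ (BettiUniverse.hodge exists_isReal_hodgeModel_holds hT' 1).piece r (((1 : ℕ) : ℤ) - r)) → f = 0 := by
    intro f hf
    refine forall_isHodgeMorphismOne_eq_zero_of_forall_hom_eq_zero hAA f ⟨fun x hx => ?_, fun x hx => ?_⟩
    · have hx' := (BettiUniverse.mem_hodge_piece_iff exists_isReal_hodgeModel_holds hodgePQ_independent_of_hodgeModel_holds hT (k := 1)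
        (p := 1) (q := 0) rfl _).2 hx
      have e : (((1 : ℕ) : ℤ) - 1) = 0 := by norm_num
      have h := hf 1 x (by rw [e]; exact hx')
      rw [e] at h
      exact (BettiUniverse.mem_hodge_piece_iff exists_isReal_hodgeModel_holds hodgePQ_independent_of_hodgeModel_holds hT' (k := 1)
        (p := 1) (q := 0) rfl _).1 h
    · have hx' := (BettiUniverse.mem_hodge_piece_iff exists_isReal_hodgeModel_holds hodgePQ_independent_of_hodgeModel_holds hT (k := 1)
        (p := 0) (q := 1) rfl _).2 hx
      have e : (((1 : ℕ) : ℤ) - 0) = 1 := by norm_num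
      have h := hf 0 x (by rw [e]; exact hx')
      rw [e] at h
      exact (BettiUniverse.mem_hodge_piece_iff exists_isReal_hodgeModel_holds hodgePQ_independent_of_hodgeModel_holds hT' (k := 1)
        (p := 0) (q := 1) rfl _).1 h
  have h9₁ : 3 * 3 ≤ A.dim * A.dim := Nat.mul_le_mul hdim hdim
  have h9₂ : 3 * 3 ≤ A'.dim * A'.dim := Nat.mul_le_mul hdim' hdim'
  have h𝔡₁0 : Submodule.span ℚ {B | ∃ X' ∈ (BettiUniverse.hodge exists_isReal_hodgeModel_holds hT 1).hodgeLie,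
      ∃ Y ∈ (BettiUniverse.hodge exists_isReal_hodgeModel_holds hT 1).hodgeLie, X' * Y - Y * X' = B} ≠ ⊥ := fun h => by
    rw [h, finrank_bot] at h8₁; omega
  have h𝔡₂0 : Submodule.span ℚ {B | ∃ X' ∈ (BettiUniverse.hodge exists_isReal_hodgeModel_holds hT' 1).hodgeLie,
      ∃ Y ∈ (BettiUniverse.hodge exists_isReal_hodgeModel_holds hT' 1).hodgeLie, X' * Y - Y * X' = B} ≠ ⊥ := fun h => by
    rw [h, finrank_bot] at h8₂; omega
  obtain ⟨hc₁, hc₂, hdimH⟩ := UnitaryPair.corners_le_and_finrank_le ι₁ π₁ ι₂ π₂ hπι₁ hπι₂ hsum Nat.cast_one heff₁ heff₂ ψ₁ ψ₂ ψ hφ₁E hd₁Q hφ₁2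
    hE₁ hμ₁ h1₁ h2₁ hφ₂E hd₂Q hφ₂2 hE₂ hμ₂ h1₂ h2₂ (hodgeLie_rigid_of_ribetTypeOne hT φ hd hφ hAE h1 hdim)
    (hodgeLie_rigid_of_ribetTypeOne hT' φ' hd' hφ' hA'E h1' hdim') hZ hφ₁𝔥 (hZ₁ ψ₁) (hZ₂ ψ₂) hsimple₁ hsimple₂ hcent₁ hcent₂ h𝔡₁0 h𝔡₂0 hnohom
  rw [h8₁, h8₂] at hdimH
  refine ⟨hdimH, fun hfor => ?_⟩
  -- different fields: the central plane
  have hfree : ∀ s : ℚ, (d : ℚ) ≠ s ^ 2 * d' := forall_ne_sq_mul_of_isEmpty_ringHom hfor hA'E hd' hφ' hφ hd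
  obtain ⟨hE₁𝔥, hE₂𝔥⟩ := UnitaryPair.incl_phi_proj_mem_hodgeLie_of_nonresonant ι₁ π₁ ι₂ π₂ hπι₁ hπι₂ hsum hφ₁E hφ₂E ψ hZ hd₁Q hφ₁2 hd₂Q hφ₂2
    hσ₁ hσ₂ hk₁ hk₂ hτ₁ hτ₂ hfree
  have h := UnitaryPair.finrank_add_finrank_add_two_le_of_corners ι₁ π₁ ι₂ π₂ hπι₁ hπι₂ hsum hφ₁E hφ₂E hd₁Q hφ₁2 hd₂Q hφ₂2 hc₁ hc₂ hE₁𝔥 hE₂𝔥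
  rw [h8₁, h8₂] at h
  exact h

/-! ## §2 The exact cells `g² + g′² + 1` and `2g²`, the general interval, and the dichotomy -/

/-- **`t(X) = g² + g′² + 1 = t(A) + t(A′) − 1` for `X ∼ A × A′`, `A`, `A′` of Ribet types `(g−1,1)`, `(g′−1,1)` with NON-ISOMORPHIC fields** (no ring
homomorphism `End⁰A′ → End⁰A`; then `A ≁ A′` automatically, Mumford §19): `Hg(A × A′) = U(H¹A) × U(H¹A′)` — lower bound §1, upper bound the
subadditivity `t(X) + 1 ≤ t(A) + t(A′)`. [cite: MoonenZarhin1999LowDim, §3 (3.1) and Prop. (3.8)] [cite: MumfordAV1970, §19] [cite: Ribet1983, Thm. 3] -/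
theorem mtRank_hodge_one_eq_of_isIsogenous_prod_ribetTypeOne_of_isEmpty_ringHom (hX : IsSmoothProjective n X.X) {A A' : AbelianVariety ℂ}
    (hF : IsField A.endAlgebra) (hnR : ¬ IsTotallyReal (EndField A hF)) (φ : A ⟶ A) {d : ℕ} (hd : 0 < d) (hφ : φ ≫ φ = -(d • 𝟙 A))
    (hAE : Module.finrank ℚ A.endAlgebra = 2)
    (h1 : eigenMultiplicity A φ (Complex.I * (Real.sqrt d : ℂ)) = 1 ∨ eigenMultiplicity A φ (-(Complex.I * (Real.sqrt d : ℂ))) = 1) (hdim : 3 ≤ A.dim)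
    (hF' : IsField A'.endAlgebra) (hnR' : ¬ IsTotallyReal (EndField A' hF')) (φ' : A' ⟶ A') {d' : ℕ} (hd' : 0 < d') (hφ' : φ' ≫ φ' = -(d' • 𝟙 A'))
    (hA'E : Module.finrank ℚ A'.endAlgebra = 2)
    (h1' : eigenMultiplicity A' φ' (Complex.I * (Real.sqrt d' : ℂ)) = 1 ∨ eigenMultiplicity A' φ' (-(Complex.I * (Real.sqrt d' : ℂ))) = 1)
    (hdim' : 3 ≤ A'.dim) (hfor : IsEmpty (A'.endAlgebra →+* A.endAlgebra)) (hXP : IsIsogenous X (A.prod A')) :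
    haveI := BettiUniverse.finite hX 1
    (BettiUniverse.hodge exists_isReal_hodgeModel_holds hX 1).mtRank = A.dim * A.dim + A'.dim * A'.dim + 1 := by
  haveI := BettiUniverse.finite hX 1
  have hP : IsSmoothProjective (A.prod A').dim (A.prod A').X := AbelianVariety.isSmoothProjective_holds
  have hT : IsSmoothProjective A.dim A.X := AbelianVariety.isSmoothProjective_holds
  have hT' : IsSmoothProjective A'.dim A'.X := AbelianVariety.isSmoothProjective_holds
  haveI := BettiUniverse.finite hP 1
  haveI := BettiUniverse.finite hT 1
  haveI := BettiUniverse.finite hT' 1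
  have hni : ¬ IsIsogenous A A' := fun h => by
    obtain ⟨e⟩ := h.nonempty_endAlgebra_algEquiv
    exact hfor.false (e.symm : A'.endAlgebra →+* A.endAlgebra)
  have h0 : 0 < X.dim := by
    obtain ⟨g, hg⟩ := hXP
    rw [dim_eq_of_isIsogeny hg, dim_prod]; omega
  have hlow := (finrank_hodgeLie_hodge_one_prod_ribetTypeOne_ge hP hF hnR φ hd hφ hAE h1 hdim hF' hnR' φ' hd' hφ' hA'E h1' hdim' hni).2 hfor
  rw [← finrank_hodgeLie_hodge_one_eq_of_isIsogenous hX hP hXP] at hlow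
  have hup := mtRank_hodge_one_add_one_le_add_of_isIsogenous_prod hT hT' (by omega) (by omega) hX hXP
  rw [(mtRank_hodge_one_of_ribetTypeOne' hT hF hnR φ hd hφ hAE h1 hdim).1, (mtRank_hodge_one_of_ribetTypeOne' hT' hF' hnR' φ' hd' hφ' hA'E h1' hdim').1]
    at hup
  rw [mtRank_hodge_one_eq_finrank_hodgeLie_add_one hX h0] at hup ⊢
  have h9₁ : 1 ≤ A.dim * A.dim := Nat.one_le_iff_ne_zero.2 (Nat.mul_ne_zero (by omega) (by omega))
  have h9₂ : 1 ≤ A'.dim * A'.dim := Nat.one_le_iff_ne_zero.2 (Nat.mul_ne_zero (by omega) (by omega))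
  omega

/-- **`t(X) = 2g²` for `X ∼ A × A′`, `A ≁ A′` of Ribet type `(g−1,1)` of the SAME dimension `g` with a COMMON root `φ ∘ φ = −D = φ′ ∘ φ′`**
(isomorphic fields): `Hg(A × A′) ⊇ SU(H¹A) × SU(H¹A′)` with ONE central torus — the Weil classes of the diagonal action cut the second torus
(`CorCM/MumfordTateRankTypeIVThreefoldPairs`, gen 48), the unitary Lemma (3.4) forces both special unitary factors (§1).
[cite: MoonenZarhin1999LowDim, §3 (3.1), Lemma (3.4) and Thm. 0.1 (4)] [cite: Deligne1982HodgeCycles, §4 Prop. 4.4] [cite: Ribet1983, Thm. 3] -/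
theorem mtRank_hodge_one_eq_of_isIsogenous_prod_ribetTypeOne_of_comp_self_eq_neg (hX : IsSmoothProjective n X.X) {A A' : AbelianVariety ℂ}
    (hF : IsField A.endAlgebra) (hnR : ¬ IsTotallyReal (EndField A hF)) (φ : A ⟶ A) {D : ℕ} (hD : 0 < D) (hφ : φ ≫ φ = -(D • 𝟙 A))
    (hAE : Module.finrank ℚ A.endAlgebra = 2)
    (h1 : eigenMultiplicity A φ (Complex.I * (Real.sqrt D : ℂ)) = 1 ∨ eigenMultiplicity A φ (-(Complex.I * (Real.sqrt D : ℂ))) = 1)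
    (hF' : IsField A'.endAlgebra) (hnR' : ¬ IsTotallyReal (EndField A' hF')) (φ' : A' ⟶ A') (hφ' : φ' ≫ φ' = -(D • 𝟙 A'))
    (hA'E : Module.finrank ℚ A'.endAlgebra = 2)
    (h1' : eigenMultiplicity A' φ' (Complex.I * (Real.sqrt D : ℂ)) = 1 ∨ eigenMultiplicity A' φ' (-(Complex.I * (Real.sqrt D : ℂ))) = 1)
    (hdim : 3 ≤ A.dim) (hdd : A'.dim = A.dim) (hni : ¬ IsIsogenous A A') (hXP : IsIsogenous X (A.prod A')) :
    haveI := BettiUniverse.finite hX 1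
    (BettiUniverse.hodge exists_isReal_hodgeModel_holds hX 1).mtRank = 2 * (A.dim * A.dim) := by
  haveI := BettiUniverse.finite hX 1
  have hP : IsSmoothProjective (A.prod A').dim (A.prod A').X := AbelianVariety.isSmoothProjective_holds
  haveI := BettiUniverse.finite hP 1
  have hle := (mtRank_hodge_one_mem_Icc_of_isIsogenous_prod_ribetTypeOne_of_comp_self_eq_neg hX hF hnR φ hD hφ hAE h1 hF' hnR' φ' hφ' hA'E h1'
    hdim hdd hXP).2
  have h0 : 0 < X.dim := by
    obtain ⟨g, hg⟩ := hXP
    rw [dim_eq_of_isIsogeny hg, dim_prod]; omega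
  have hlow := (finrank_hodgeLie_hodge_one_prod_ribetTypeOne_ge hP hF hnR φ hD hφ hAE h1 hdim hF' hnR' φ' hD hφ' hA'E h1' (by omega) hni).1
  rw [← finrank_hodgeLie_hodge_one_eq_of_isIsogenous hX hP hXP, hdd] at hlow
  rw [mtRank_hodge_one_eq_finrank_hodgeLie_add_one hX h0] at hle ⊢
  have h9 : 1 ≤ A.dim * A.dim := Nat.one_le_iff_ne_zero.2 (Nat.mul_ne_zero (by omega) (by omega))
  omega

/-- **`g² + g′² ≤ t(X) ≤ g² + g′² + 1` for `X ∼ A × A′`, `A ≁ A′` of Ribet types `(g−1,1)`, `(g′−1,1)`** (lower bound §1: both special unitary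
factors and at least one central torus; upper bound: subadditivity).  Exact value: `+ 1` iff the fields differ (this file); for `g = g′` and a
common root it is `g² + g′² = 2g²`. [cite: MoonenZarhin1999LowDim, §3 (3.1), Lemma (3.4) and Prop. (3.8)] [cite: Ribet1983, Thm. 3] -/
theorem mtRank_hodge_one_mem_Icc_of_isIsogenous_prod_ribetTypeOne (hX : IsSmoothProjective n X.X) {A A' : AbelianVariety ℂ}
    (hF : IsField A.endAlgebra) (hnR : ¬ IsTotallyReal (EndField A hF)) (φ : A ⟶ A) {d : ℕ} (hd : 0 < d) (hφ : φ ≫ φ = -(d • 𝟙 A))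
    (hAE : Module.finrank ℚ A.endAlgebra = 2)
    (h1 : eigenMultiplicity A φ (Complex.I * (Real.sqrt d : ℂ)) = 1 ∨ eigenMultiplicity A φ (-(Complex.I * (Real.sqrt d : ℂ))) = 1) (hdim : 3 ≤ A.dim)
    (hF' : IsField A'.endAlgebra) (hnR' : ¬ IsTotallyReal (EndField A' hF')) (φ' : A' ⟶ A') {d' : ℕ} (hd' : 0 < d') (hφ' : φ' ≫ φ' = -(d' • 𝟙 A'))
    (hA'E : Module.finrank ℚ A'.endAlgebra = 2)
    (h1' : eigenMultiplicity A' φ' (Complex.I * (Real.sqrt d' : ℂ)) = 1 ∨ eigenMultiplicity A' φ' (-(Complex.I * (Real.sqrt d' : ℂ))) = 1)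
    (hdim' : 3 ≤ A'.dim) (hni : ¬ IsIsogenous A A') (hXP : IsIsogenous X (A.prod A')) :
    haveI := BettiUniverse.finite hX 1
    (BettiUniverse.hodge exists_isReal_hodgeModel_holds hX 1).mtRank ∈
      Set.Icc (A.dim * A.dim + A'.dim * A'.dim) (A.dim * A.dim + A'.dim * A'.dim + 1) := by
  haveI := BettiUniverse.finite hX 1
  have hP : IsSmoothProjective (A.prod A').dim (A.prod A').X := AbelianVariety.isSmoothProjective_holds
  have hT : IsSmoothProjective A.dim A.X := AbelianVariety.isSmoothProjective_holds
  have hT' : IsSmoothProjective A'.dim A'.X := AbelianVariety.isSmoothProjective_holds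
  haveI := BettiUniverse.finite hP 1
  haveI := BettiUniverse.finite hT 1
  haveI := BettiUniverse.finite hT' 1
  have h0 : 0 < X.dim := by
    obtain ⟨g, hg⟩ := hXP
    rw [dim_eq_of_isIsogeny hg, dim_prod]; omega
  have hlow := (finrank_hodgeLie_hodge_one_prod_ribetTypeOne_ge hP hF hnR φ hd hφ hAE h1 hdim hF' hnR' φ' hd' hφ' hA'E h1' hdim' hni).1
  rw [← finrank_hodgeLie_hodge_one_eq_of_isIsogenous hX hP hXP] at hlow
  have hup := mtRank_hodge_one_add_one_le_add_of_isIsogenous_prod hT hT' (by omega) (by omega) hX hXP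
  rw [(mtRank_hodge_one_of_ribetTypeOne' hT hF hnR φ hd hφ hAE h1 hdim).1, (mtRank_hodge_one_of_ribetTypeOne' hT' hF' hnR' φ' hd' hφ' hA'E h1' hdim').1]
    at hup
  rw [mtRank_hodge_one_eq_finrank_hodgeLie_add_one hX h0] at hup ⊢
  have h9₁ : 1 ≤ A.dim * A.dim := Nat.one_le_iff_ne_zero.2 (Nat.mul_ne_zero (by omega) (by omega))
  have h9₂ : 1 ≤ A'.dim * A'.dim := Nat.one_le_iff_ne_zero.2 (Nat.mul_ne_zero (by omega) (by omega))
  exact ⟨by omega, by omega⟩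

/-- **Dichotomy for two Ribet-type `(g−1,1)` varieties of the same dimension with a common root: `t(A × A′) = g² + 1` or `2g²`** according as
`A ∼ A′` or not (for `A ∼ A′`, `X ∼ A × A` and `t(A × A) = t(A) = g² + 1`, `CorCM/MumfordTateRankOfPowers`).
[cite: MoonenZarhin1999LowDim, §3 (3.1), Lemma (3.4) and Thm. 0.1 (4)] [cite: Ribet1983, Thm. 3] -/
theorem mtRank_hodge_one_dichotomy_of_isIsogenous_prod_ribetTypeOne_of_comp_self_eq_neg (hX : IsSmoothProjective n X.X) {A A' : AbelianVariety ℂ}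
    (hF : IsField A.endAlgebra) (hnR : ¬ IsTotallyReal (EndField A hF)) (φ : A ⟶ A) {D : ℕ} (hD : 0 < D) (hφ : φ ≫ φ = -(D • 𝟙 A))
    (hAE : Module.finrank ℚ A.endAlgebra = 2)
    (h1 : eigenMultiplicity A φ (Complex.I * (Real.sqrt D : ℂ)) = 1 ∨ eigenMultiplicity A φ (-(Complex.I * (Real.sqrt D : ℂ))) = 1)
    (hF' : IsField A'.endAlgebra) (hnR' : ¬ IsTotallyReal (EndField A' hF')) (φ' : A' ⟶ A') (hφ' : φ' ≫ φ' = -(D • 𝟙 A'))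
    (hA'E : Module.finrank ℚ A'.endAlgebra = 2)
    (h1' : eigenMultiplicity A' φ' (Complex.I * (Real.sqrt D : ℂ)) = 1 ∨ eigenMultiplicity A' φ' (-(Complex.I * (Real.sqrt D : ℂ))) = 1)
    (hdim : 3 ≤ A.dim) (hdd : A'.dim = A.dim) (hXP : IsIsogenous X (A.prod A')) :
    haveI := BettiUniverse.finite hX 1
    (IsIsogenous A A' ∧ (BettiUniverse.hodge exists_isReal_hodgeModel_holds hX 1).mtRank = A.dim * A.dim + 1) ∨
      (¬ IsIsogenous A A' ∧ (BettiUniverse.hodge exists_isReal_hodgeModel_holds hX 1).mtRank = 2 * (A.dim * A.dim)) := by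
  haveI := BettiUniverse.finite hX 1
  by_cases hAA' : IsIsogenous A A'
  · left
    have hT : IsSmoothProjective A.dim A.X := AbelianVariety.isSmoothProjective_holds
    haveI := BettiUniverse.finite hT 1
    refine ⟨hAA', ?_⟩
    rw [mtRank_hodge_one_eq_of_isIsogenous_powSucc hX hT (by omega) (m := 1) (hXP.trans ((IsIsogenous.refl A).prod hAA'.symm')),
      (mtRank_hodge_one_of_ribetTypeOne' hT hF hnR φ hD hφ hAE h1 hdim).1]
  · right
    exact ⟨hAA', mtRank_hodge_one_eq_of_isIsogenous_prod_ribetTypeOne_of_comp_self_eq_neg hX hF hnR φ hD hφ hAE h1 hF' hnR' φ' hφ' hA'E h1' hdim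
      hdd hAA' hXP⟩

end Summit.HodgeConjecture.CorCM

end
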